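import Summits.BirchSwinnertonDyer.BirchSwinnertonDyer.Theorems.CumulativeHeegnerLeopoldtCumulativeHeegnerInclusionAtThreeLayerLocalKernelBound
import HarnessLib

/-!
# Crux K1 `CumulativeHeegnerInclusionAtThree` (stmt-BirchSwinnertonDyer-24198) / crux A (stmt-26896): the port [P-ctl],
# IX-b — Greenberg's Lemma 3.3 along the tower, `subgroupH1`/`decomp` currency: the LITERAL bounded-order form, the
# uniform annihilator at ALL `v ∤ p` (good places contribute nothing), and the PRIMITIVE (`Σ = ∅`) layer-tower doors

Width seat bsd-line-chl-k1-p1-w2 g10 (`--supports stmt-BirchSwinnertonDyer-24198`). THEOREMS ONLY (no definition, no named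
fact, no `sorry`); §1–§2 ROUTE-INDEPENDENT. Sequel of `…LayerLocalKernelBound` (IX, p657494: `∃ a ∀ n`, `p^a` kills
`ker (H¹(κ⁻¹(pⁿℤ_p) ⊓ D_v, E[p^∞]) → H¹(ker κ ⊓ D_v, E[p^∞]))` at every bad `v ∤ p`).

* §1 `resOfLe_layer_inf_decomp_eq_zero_of_hasGoodReductionAt` — at a GOOD `v ∤ p` that kernel is ZERO at every layer
  (`H¹(κ⁻¹(pⁿℤ_p) ⊓ D_v, E[p^∞]) ↪ H¹(I_v, E[p^∞])`, UTD's `resOfLe_inertia_injective_of_isOpen`, and `I_v ≤ ker κ ⊓ D_v`);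
  `exists_uniform_pow_smul_eq_zero_of_not_mem` — hence ONE exponent `a` for all layers `n` and ALL finite `v ∤ p`
  (Greenberg, LNM 1716, eq. (4): "this bound is independent of `n` and `v_n`"; good `v`: "`ker(r_v) = 0`", p. 87).
* §2 **`exists_natCard_ker_resOfLe_le`** — Greenberg's Lemma 3.3 AS PRINTED ("`ker(r_{v_n})` is finite and has bounded order
  as `n` varies", PDF p. 86), in this currency: for `v ∤ p` there is `C` with `ker (H¹(κ⁻¹(pⁿℤ_p) ⊓ D_v, E[p^∞]) →
  H¹(ker κ ⊓ D_v, E[p^∞]))` finite of order `≤ C` for every `n` (`C = sup_j #(B/p^jB)`, `B = E[p^∞]^{ker κ ⊓ D_v}`; the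
  kernel embeds in `B/(g_n − 1)B`, a quotient of `B/p^{j₀}B` — same ingredients as IX).
* §3 the PRIMITIVE doors (Leopoldt cell, `p = 3`, `Σ = ∅` fixed): **`temperedHeegnerInclusionAtThree_of_primitiveFittingLayerTower`**
  — A BY NAME from: at every frame, `∃ μ ∀ m`, a layer element `θ_m ∈ Fitt_Λ(Hom(Sel_{𝔭′}(K_m, E[3^∞]), ℚ/ℤ))·R₀⟦T⟧` (dual of the
  PRIMITIVE finite-layer Selmer group, any presentation) with `3^μ L ∈ (θ_m) + (3^m) + (ω_m)`; and
  **`cumulativeHeegnerInclusionAtThree_of_print_of_primitiveFittingLayerTower`** (K1 BY NAME from P ∧ the same) — the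
  simplest statement of the layer-tower line: its only inputs are [R-layer-KS] (the `θ_m`, `μ` uniform) and [R-layer-rec].

Crux A (26896) and K1 (24198) stay OPEN; BSD is not proved by any of this; no summit statement is proved by this seat.

References: [GreenbergLNM1716] §3 Lemma 3.3 with eq. (4) (PDF pp. 86–88); [GreenbergVatsal2000] §2 p. 17;
[SerreGaloisCohomology1997] I.§2.6; [MazurTate1987] §1; [CastellaGrossiLeeSkinner2022] §1.2 Prop. 14 (arXiv:2008.02571).
-/

set_option linter.dupNamespace false
set_option autoImplicit false

noncomputable section

open scoped Classical AddSubgroup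

namespace Summit.BirchSwinnertonDyer.BirchSwinnertonDyer.Theorems.CumulativeHeegnerInclusionAtThreeLayerLocalKernelCount

open NumberField IsDedekindDomain Field
open Literature.NumberTheory.EllipticCurves Literature.NumberTheory.EllipticCurves.GreenbergSelmer
open Literature.NumberTheory.EllipticCurves.IwasawaDual
open Literature.NumberTheory.GaloisRepresentations Literature.NumberTheory.EllipticCurves.ResKernel
open Literature.RingTheory.FittingIdeal
open Summit.BirchSwinnertonDyer.Rank1Residual.X11b Summit.BirchSwinnertonDyer.Rank1Residual.X11b.AcSelmer
open Summit.BirchSwinnertonDyer.BirchSwinnertonDyer.Theorems.BiquadraticEisensteinDescentDefs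
open Summit.BirchSwinnertonDyer.BirchSwinnertonDyer.Theorems.CumulativeHeegnerInclusionAtThreeLayerControlCurve
open Summit.BirchSwinnertonDyer.BirchSwinnertonDyer.Theorems.CumulativeHeegnerInclusionAtThreeLayerLocalKernelBound

/-! ## §1 Good places contribute nothing; one exponent for ALL `v ∤ p` -/

section Generic

variable {K : Type} [Field K] [NumberField K] {p : ℕ} [Fact p.Prime] (κ : ZpExtension K p)
  (W : WeierstrassCurve K) [W.IsElliptic]

/-- **At a GOOD `v ∤ p` the layer-`n` local kernel vanishes**: if `y ∈ H¹(κ⁻¹(pⁿℤ_p) ⊓ D_v, E[p^∞])` restricts to `0` on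
`ker κ ⊓ D_v` then `y = 0` — both contain the inertia group `I_v` of the chosen prime (`ℤ_p`-extensions are unramified at
`v ∤ p`), and `H¹(κ⁻¹(pⁿℤ_p) ⊓ D_v, E[p^∞]) → H¹(I_v, E[p^∞])` is injective at a good place (UTD
`resOfLe_inertia_injective_of_isOpen` for the open subgroup `κ⁻¹(pⁿℤ_p) ⊇ I_v`). Greenberg: "if `E` has good reduction at `v`,
then … `ker(r_v) = 0`" (LNM 1716, p. 87), at every layer. [cite: GreenbergLNM1716, §3 Lemma 3.3 (proof, PDF p. 87)]
[cite: GreenbergVatsal2000, §2 p. 17] -/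
theorem resOfLe_layer_inf_decomp_eq_zero_of_hasGoodReductionAt {v : HeightOneSpectrum (𝓞 K)}
    (hpv : (p : 𝓞 K) ∉ v.asIdeal) (hv : W.HasGoodReductionAt v) (n : ℕ)
    (y : W.subgroupH1 p (κ.layerSubgroup n ⊓ decomp v))
    (hy : W.resOfLe p (inf_le_inf_right (decomp v) (κ.kerSubgroup_le_layerSubgroup n)) y = 0) : y = 0 := by
  have h𝔓₀ := adicCompletionPrime_mem_primesAbove K v
  have hIK : (adicCompletionPrime K v).inertia (absoluteGaloisGroup K) ≤ κ.kerSubgroup ⊓ decomp v :=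
    le_inf (ZpExtension.inertia_le_kerSubgroup_holds K p κ hpv h𝔓₀) (inertia_adicCompletionPrime_le_decomp v)
  have e : resOfLe (W.geomPrimaryTorsion p) hIK
      (resOfLe (W.geomPrimaryTorsion p) (inf_le_inf_right (decomp v) (κ.kerSubgroup_le_layerSubgroup n)) y) =
      resOfLe (W.geomPrimaryTorsion p)
        (le_inf (inertia_le_layerSubgroup p κ hpv n) (inertia_adicCompletionPrime_le_decomp v)) y := by
    rw [← AddMonoidHom.comp_apply, resOfLe_comp_holds]
  have h0 : resOfLe (W.geomPrimaryTorsion p)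
      (le_inf (inertia_le_layerSubgroup p κ hpv n) (inertia_adicCompletionPrime_le_decomp v)) y = 0 := by
    rw [← e, show resOfLe (W.geomPrimaryTorsion p)
      (inf_le_inf_right (decomp v) (κ.kerSubgroup_le_layerSubgroup n)) y = 0 from hy, map_zero]
  exact (injective_iff_map_eq_zero _).mp
    (UniversalToricDescentResidualSelmerLocal.resOfLe_inertia_injective_of_isOpen W p hpv hv
      (κ.isOpen_layerSubgroup n) (inertia_le_layerSubgroup p κ hpv n)) _ h0

/-- **One exponent for all layers and ALL finite `v ∤ p`** (good places: the kernel is `0`; bad places: IX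
`exists_uniform_pow_smul_eq_zero`). Greenberg, eq. (4): "independent of `n` and `v_n`".
[cite: GreenbergLNM1716, §3 Lemma 3.3 with eq. (4) (PDF pp. 86–88)] -/
theorem exists_uniform_pow_smul_eq_zero_of_not_mem :
    ∃ a : ℕ, ∀ (n : ℕ) (v : HeightOneSpectrum (𝓞 K)), (p : 𝓞 K) ∉ v.asIdeal →
      ∀ y : W.subgroupH1 p (κ.layerSubgroup n ⊓ decomp v),
        W.resOfLe p (inf_le_inf_right (decomp v) (κ.kerSubgroup_le_layerSubgroup n)) y = 0 → p ^ a • y = 0 := by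
  obtain ⟨a, ha⟩ := exists_uniform_pow_smul_eq_zero κ W
  refine ⟨a, fun n v hpv y hy ↦ ?_⟩
  by_cases hv : W.HasGoodReductionAt v
  · rw [resOfLe_layer_inf_decomp_eq_zero_of_hasGoodReductionAt κ W hpv hv n y hy, smul_zero]
  · exact ha n v hpv hv y hy

/-! ## §2 Greenberg's Lemma 3.3 as printed: finite kernel of BOUNDED ORDER along the tower -/

/-- **Greenberg's Lemma 3.3 (LNM 1716, p. 86) in the `subgroupH1`/`decomp` currency**: for an elliptic curve `E` over a number
field `K`, a prime `p`, a `ℤ_p`-extension `κ` and a finite place `v ∤ p`, the kernels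
`ker (H¹(κ⁻¹(pⁿℤ_p) ⊓ D_v, E[p^∞]) → H¹(ker κ ⊓ D_v, E[p^∞]))` ("`ker(r_{v_n})`") are finite of order bounded INDEPENDENTLY of
`n`: with `B = E[p^∞]^{ker κ ⊓ D_v}`, the kernel embeds in `B/(g_n − 1)B` (inflation–restriction,
`ResKernel.exists_addMonoidHom_subgroupResKer_injective`), `(g_n − 1)B ⊇ p^{j₀}B = B_div` (`PrimaryGroup.le_range_of_finite_ker`, the
kernel of `g_n − 1` lying in the finite `E[p^∞]^{κ⁻¹(pⁿℤ_p) ⊓ D_v}`, IX `finite_fixedPoints_layer_inf_decomp`), and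
`#(B/p^jB) ≤ C` uniformly (`PrimaryGroup.exists_card_quotient_powRange_le`) — eq. (4) `#ker(r_{v_n}) ≤ #(B_v/(B_v)_div)`.
[cite: GreenbergLNM1716, §3 Lemma 3.3 with eq. (4) (PDF pp. 86–88)] [cite: SerreGaloisCohomology1997, I.§2.6] -/
theorem exists_natCard_ker_resOfLe_le {v : HeightOneSpectrum (𝓞 K)} (hpv : (p : 𝓞 K) ∉ v.asIdeal) :
    ∃ C : ℕ, ∀ n : ℕ,
      Finite ↥(W.resOfLe p (inf_le_inf_right (decomp v) (κ.kerSubgroup_le_layerSubgroup n))).ker ∧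
        Nat.card ↥(W.resOfLe p (inf_le_inf_right (decomp v) (κ.kerSubgroup_le_layerSubgroup n))).ker ≤ C := by
  classical
  -- notation: `M = E[p^∞]`, `B = M^{ker κ ⊓ D_v}`
  let M : Type := ↥(W.geomPrimaryTorsion p)
  let B : AddSubgroup M := FixedPoints.addSubgroup ↥(κ.kerSubgroup ⊓ decomp v) M
  have hcont : ∀ m : M, Continuous fun σ : absoluteGaloisGroup K ↦ σ • m :=
    W.continuous_smul_geomPrimaryTorsion p
  have hMprim : ∀ m : M, ∃ k : ℕ, p ^ k • m = 0 := fun m ↦ by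
    obtain ⟨k, hk⟩ := m.2
    exact ⟨k, Subtype.ext (by rw [AddSubgroupClass.coe_nsmul, hk, ZeroMemClass.coe_zero])⟩
  have hBprim : ∀ b : B, ∃ k : ℕ, p ^ k • b = 0 := fun b ↦ by
    obtain ⟨k, hk⟩ := hMprim b
    exact ⟨k, Subtype.ext (by rw [AddSubgroupClass.coe_nsmul, hk, ZeroMemClass.coe_zero])⟩
  haveI : Finite (B[p]) := by
    haveI := W.finite_torsionBy_geomPrimaryTorsion p 1
    refine Finite.of_injective
      (fun x : B[p] ↦ (⟨((x : B) : M), ?_⟩ : (W.geomPrimaryTorsion p)[(p ^ 1 : ℕ)])) ?_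
    · have hx : p • (x : B) = 0 := AddSubgroup.torsionBy.nsmul_iff.mp x.2
      rw [AddSubgroup.torsionBy.nsmul_iff, pow_one]
      have := congrArg (fun z : B ↦ (z : M)) hx
      simpa only [AddSubgroupClass.coe_nsmul, ZeroMemClass.coe_zero] using this
    · intro a b hab
      apply Subtype.ext; apply Subtype.ext
      exact congrArg (fun z : (W.geomPrimaryTorsion p)[(p ^ 1 : ℕ)] ↦ (z : M)) hab
  -- the uniform bound `#(B/p^jB) ≤ t` and the stable image `p^{j₀}B`
  obtain ⟨t, ht⟩ := PrimaryGroup.exists_card_quotient_powRange_le p hBprim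
  obtain ⟨j₀, hj₀⟩ := PrimaryGroup.exists_powRange_succ_eq p hBprim
  have hDdiv : ∀ d ∈ (nsmulAddMonoidHom (p ^ j₀) : B →+ B).range,
      ∃ d' ∈ (nsmulAddMonoidHom (p ^ j₀) : B →+ B).range, p • d' = d := by
    intro d hd
    rw [← hj₀] at hd
    obtain ⟨c, rfl⟩ := hd
    exact ⟨p ^ j₀ • c, ⟨c, rfl⟩, by rw [nsmulAddMonoidHom_apply, smul_smul, ← pow_succ']⟩
  refine ⟨t, fun n ↦ ?_⟩
  -- the layer group `Gn`, `N = ker κ`, a generator `g`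
  let Gn : Subgroup (absoluteGaloisGroup K) := κ.layerSubgroup n ⊓ decomp v
  let N : Subgroup ↥Gn := κ.kerSubgroup.subgroupOf Gn
  have hle : κ.kerSubgroup ⊓ decomp v ≤ Gn :=
    inf_le_inf_right (decomp v) (κ.kerSubgroup_le_layerSubgroup n)
  obtain ⟨g, hgen⟩ := exists_mem_layer_inf_decomp_generate κ v n
  have hgD : (g : absoluteGaloisGroup K) ∈ decomp v := (Subgroup.mem_inf.mp g.2).2
  have hcont' : ∀ m : M, Continuous fun x : ↥Gn ↦ x • m := fun m ↦
    (hcont m).comp continuous_subtype_val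
  -- `φ = g − 1` on `B`, finite kernel, `(g − 1)B ⊇ p^{j₀}B`
  let φ : B →+ B := decompSubOne κ M (g : absoluteGaloisGroup K) hgD
  have hφ : ∀ b : B, ((φ b : B) : M) = (g : absoluteGaloisGroup K) • (b : M) - (b : M) := fun _ ↦ rfl
  haveI hφker : Finite φ.ker := by
    haveI := finite_fixedPoints_layer_inf_decomp κ W hpv n
    refine Finite.of_injective
      (fun x : φ.ker ↦ (⟨((x : B) : M), ?_⟩ : FixedPoints.addSubgroup ↥Gn M)) ?_
    · have hx : φ (x : B) = 0 := (AddMonoidHom.mem_ker).mp x.2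
      have hgx : (g : absoluteGaloisGroup K) • ((x : B) : M) = ((x : B) : M) := by
        have h1 := congrArg (fun z : B ↦ (z : M)) hx
        simp only [hφ, ZeroMemClass.coe_zero] at h1
        exact sub_eq_zero.mp h1
      let U : Subgroup ↥Gn := MulAction.stabilizer ↥Gn ((x : B) : M)
      have hUopen : IsOpen (U : Set ↥Gn) :=
        (isOpen_discrete ({((x : B) : M)} : Set M)).preimage (hcont' ((x : B) : M))
      have hNU : N ≤ U := fun z hz ↦ by
        rw [MulAction.mem_stabilizer_iff]
        exact (x : B).2 ⟨((z : ↥Gn) : absoluteGaloisGroup K),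
          Subgroup.mem_inf.mpr ⟨Subgroup.mem_subgroupOf.mp hz, (Subgroup.mem_inf.mp (z : ↥Gn).2).2⟩⟩
      have hgU : g ∈ U := by rw [MulAction.mem_stabilizer_iff]; exact hgx
      have hU := hgen U hUopen hNU hgU
      intro h
      have hmem : h ∈ U := by rw [hU]; exact Subgroup.mem_top _
      exact MulAction.mem_stabilizer_iff.mp hmem
    · intro a b hab
      have h := congrArg Subtype.val hab
      exact Subtype.ext (Subtype.ext h)
  have hDφ : (nsmulAddMonoidHom (p ^ j₀) : B →+ B).range ≤ φ.range :=
    PrimaryGroup.le_range_of_finite_ker p hBprim hDdiv φ (PrimaryGroup.map_powRange_le p φ j₀)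
  -- `M^N = B`, compatibly with `g − 1`; `M^N/(g − 1) ≃ B/φ(B)`, a quotient of `B/p^{j₀}B`
  have hfix : FixedPoints.addSubgroup N M = B := by
    ext m
    simp only [FixedPoints.mem_addSubgroup]
    constructor
    · intro h x
      have hx := Subgroup.mem_inf.mp x.2
      exact h ⟨⟨(x : absoluteGaloisGroup K), hle x.2⟩, Subgroup.mem_subgroupOf.mpr hx.1⟩
    · intro h x
      exact h ⟨((x : ↥Gn) : absoluteGaloisGroup K), Subgroup.mem_inf.mpr
        ⟨Subgroup.mem_subgroupOf.mp x.2, (Subgroup.mem_inf.mp (x : ↥Gn).2).2⟩⟩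
  let e : FixedPoints.addSubgroup N M ≃+ B := AddEquiv.addSubgroupCongr hfix
  have he : AddSubgroup.map (e : FixedPoints.addSubgroup N M →+ B) (subOne N M g).range = φ.range := by
    ext b
    constructor
    · rintro ⟨x, ⟨y, rfl⟩, rfl⟩
      exact ⟨e y, Subtype.ext rfl⟩
    · rintro ⟨y, rfl⟩
      exact ⟨subOne N M g (e.symm y), ⟨e.symm y, rfl⟩, Subtype.ext rfl⟩
  let eq : FixedPoints.addSubgroup N M ⧸ (subOne N M g).range ≃+ B ⧸ φ.range :=
    QuotientAddGroup.congr _ _ e he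
  obtain ⟨hfinD, hcardD⟩ := ht j₀
  haveI := hfinD
  let πD : B ⧸ (nsmulAddMonoidHom (p ^ j₀) : B →+ B).range →+ B ⧸ φ.range :=
    QuotientAddGroup.map _ _ (AddMonoidHom.id B) (by rwa [AddSubgroup.comap_id])
  have hπD : Function.Surjective πD := by
    intro q
    induction q using QuotientAddGroup.induction_on with
    | H b => exact ⟨(b : B ⧸ (nsmulAddMonoidHom (p ^ j₀) : B →+ B).range), QuotientAddGroup.map_mk _ _ _ _ b⟩
  haveI hfinQ : Finite (B ⧸ φ.range) := Finite.of_surjective πD hπD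
  have hcardQ : Nat.card (B ⧸ φ.range) ≤ t :=
    (Nat.card_le_card_of_surjective πD hπD).trans hcardD
  -- the generic inflation–restriction embedding on `Gn`, and `ker res ⊆ subgroupResKer M N`
  obtain ⟨w, hw, -⟩ := ResKernel.exists_addMonoidHom_subgroupResKer_injective N M g hgen hcont'
  have hker : ∀ y : W.subgroupH1 p Gn,
      W.resOfLe p (inf_le_inf_right (decomp v) (κ.kerSubgroup_le_layerSubgroup n)) y = 0 →
        (y : discreteH1 (↥Gn) M) ∈ subgroupResKer M N := by
    intro y hy
    let j : N →ₜ* ↥(κ.kerSubgroup ⊓ decomp v) :=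
      { toFun := fun x ↦ ⟨((x : ↥Gn) : absoluteGaloisGroup K), Subgroup.mem_inf.mpr
          ⟨Subgroup.mem_subgroupOf.mp x.2, (Subgroup.mem_inf.mp (x : ↥Gn).2).2⟩⟩
        map_one' := rfl
        map_mul' := fun _ _ ↦ rfl
        continuous_toFun :=
          (continuous_subtype_val.comp continuous_subtype_val).subtype_mk _ }
    have hcomp : (resH1Hom j (AddMonoidHom.id M) (fun _ _ ↦ rfl)).comp
        (Literature.NumberTheory.EllipticCurves.resOfLe M hle) = resSubgroup N M := by
      unfold Literature.NumberTheory.EllipticCurves.resOfLe ResKernel.resSubgroup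
      rw [resH1Hom_comp]
      exact resH1Hom_congr (ContinuousMonoidHom.ext fun _ ↦ rfl) (AddMonoidHom.ext fun _ ↦ rfl) _ _
    rw [mem_subgroupResKer_iff, ← hcomp, AddMonoidHom.comp_apply,
      show Literature.NumberTheory.EllipticCurves.resOfLe M hle y = 0 from hy, map_zero]
  -- `ker res ↪ B/φ(B)`
  let f : ↥(W.resOfLe p (inf_le_inf_right (decomp v) (κ.kerSubgroup_le_layerSubgroup n))).ker → B ⧸ φ.range :=
    fun k ↦ eq (w ⟨((k : W.subgroupH1 p Gn) : discreteH1 (↥Gn) M), hker k ((AddMonoidHom.mem_ker).mp k.2)⟩)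
  have hf : Function.Injective f := by
    intro a b hab
    have h1 := hw (eq.injective hab)
    have h2 := congrArg (fun z : subgroupResKer M N ↦ (z : discreteH1 (↥Gn) M)) h1
    exact Subtype.ext h2
  exact ⟨Finite.of_injective f hf, (Nat.card_le_card_of_injective f hf).trans hcardQ⟩

end Generic

/-! ## §3 The PRIMITIVE layer-tower doors (`Σ = ∅`) -/

/-- **A BY NAME from the PRIMITIVE layer tower.** At every frame of crux A: a uniform `μ` and, at every layer `m`, a layer
element `θ_m ∈ Fitt_Λ(Hom(Sel_{𝔭′}(K_m, E[3^∞]), ℚ/ℤ))·R₀⟦T⟧` — the Fitting ideal of the dual of the PRIMITIVE (no `Σ`)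
finite-layer Greenberg Selmer group `selmerOver (κ.layerSubgroup m) E[3^∞] 3 𝔭′ ∅`, any presentation `(f, h)` with `f`
agreeing with `conj_γ` — such that `3^μ L ∈ (θ_m) + (3^m) + (ω_m)` ⟹ `TemperedHeegnerInclusionAtThree` (IX
`temperedHeegnerInclusionAtThree_of_fittingLayerTower_anySigma` at `S = ∅`). The existence of such `θ_m` at additive `3`
([R-layer-KS], `μ` uniform in `m`) and the congruence ([R-layer-rec]) are NOT asserted.
[cite: GreenbergLNM1716, §3 Lemma 3.3 and p. 90] [cite: MazurTate1987, §1] [cite: KimKurihara2021, §1] -/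
theorem temperedHeegnerInclusionAtThree_of_primitiveFittingLayerTower
    (hLT : ∀ (W : WeierstrassCurve ℚ) [W.IsElliptic] [W.IsGloballyMinimal] (N : ℕ) [NeZero N] (K : Type) [Field K] [NumberField K] (Dt : Literature.NumberTheory.EllipticCurves.ModularForms.ModularParametrizationData W N), Summit.BirchSwinnertonDyer.Rank1Residual.Additive.ClassO6 W 3 → Literature.NumberTheory.EllipticCurves.Rank1Residual.Red W 3 → (∃ Φ : AddSubgroup (WeierstrassCurve.geomTorsion W ((3 : ℕ) : ℤ)), Literature.NumberTheory.EllipticCurves.Rank1Residual.IsRationalLine W 3 Φ ∧ ∀ (v : IsDedekindDomain.HeightOneSpectrum (NumberField.RingOfIntegers ℚ)), ((3 : ℕ) : NumberField.RingOfIntegers ℚ) ∈ v.asIdeal → ∀ 𝔓 ∈ v.primesAbove, ¬ (∀ g ∈ 𝔓.decompositionSubgroup (Field.absoluteGaloisGroup ℚ), ∀ P ∈ Φ, g • P = P) ∧ ¬ (∀ g ∈ 𝔓.decompositionSubgroup (Field.absoluteGaloisGroup ℚ), ∀ P : WeierstrassCurve.geomTorsion W ((3 : ℕ) : ℤ), g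 • P - P ∈ Φ)) → W.analyticRank = 1 → W.conductorNorm ℤ = N → Literature.NumberTheory.EllipticCurves.IsImaginaryQuadratic K → Literature.NumberTheory.EllipticCurves.SatisfiesHeegnerHypothesis N K → ∀ (κ : Literature.NumberTheory.EllipticCurves.ZpExtension K 3), κ.IsAnticyclotomic → ∀ (γ : Field.absoluteGaloisGroup K) [Fact (κ.IsTopGenerator γ)] (𝔭 : IsDedekindDomain.HeightOneSpectrum (NumberField.RingOfIntegers K)), ((3 : ℕ) : NumberField.RingOfIntegers K) ∈ 𝔭.asIdeal → 𝔭.asIdeal.ramificationIdx (NumberField.RingOfIntegers ℚ) = 1 → 𝔭.asIdeal.inertiaDeg (NumberField.RingOfIntegers ℚ) = 1 → ∀ (𝔭' : IsDedekindDomain.HeightOneSpectrum (NumberField.RingOfIntegers K)), ((3 : ℕ) : NumberField.RingOfIntegers K) ∈ 𝔭'.asIdeal → 𝔭' ≠ 𝔭 → ∀ (ι' : PadicAlgCl 3 ≃+* ℂ), Summit.BirchSwinnertonDyer.BirchSwinnertonDyer.Theorems.SchneiderFree.BranchInducesPrime 3 ι' 𝔭 → ∀ (ΩK : ℂ) (Ωp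 : ℂ_[3]) (L : Literature.NumberTheory.EllipticCurves.UnrSeries 3), ΩK ≠ 0 → Ωp ≠ 0 → Literature.NumberTheory.EllipticCurves.IsBDPLFunction ι' 𝔭 κ γ Dt.f ΩK Ωp L →
      haveI : (W.baseChange K).IsElliptic := inferInstanceAs (W.map (algebraMap ℚ K)).IsElliptic
      ∃ μ : ℕ, ∀ m : ℕ,
        ∃ (f : AddMonoid.End ↥(selmerOver (κ.layerSubgroup m) ((W.baseChange K).geomPrimaryTorsion 3) 3 𝔭' ∅))
          (_ : ∀ s, ((f s : selmerOver (κ.layerSubgroup m) ((W.baseChange K).geomPrimaryTorsion 3) 3 𝔭' ∅) :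
            (W.baseChange K).subgroupH1 3 (κ.layerSubgroup m)) = (W.baseChange K).conjH1 3 (κ.layerSubgroup m) γ s)
          (h : IsLocNil 3 (f - 1)) (θ : UnrSeries 3),
          θ ∈ (Module.fittingIdeal (IwasawaAlgebra 3)
            (LocNilDual (selmerOver (κ.layerSubgroup m) ((W.baseChange K).geomPrimaryTorsion 3) 3 𝔭' ∅) f h) 0).map
              (PowerSeries.map (Halves.toUnr 3)) ∧
          (3 : UnrSeries 3) ^ μ * L ∈ Ideal.span {θ} ⊔ Ideal.span {(3 : UnrSeries 3) ^ m} ⊔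
            Ideal.span {((1 + PowerSeries.X) ^ (3 ^ m) - 1 : UnrSeries 3)}) :
    Summit.BirchSwinnertonDyer.BirchSwinnertonDyer.Theses.CumulativeHeegnerLeopoldt.TemperedHeegnerInclusionAtThree := by
  refine temperedHeegnerInclusionAtThree_of_fittingLayerTower_anySigma ?_
  intro W _ _ N _ K _ _ Dt hO6 hRed hcell hr hN hK hHg κ hκ γ _ 𝔭 h𝔭 he hf 𝔭' h𝔭' hne ι' hι ΩK Ωp L hΩK hΩp hBDP
  obtain ⟨μ, hT⟩ := hLT W N K Dt hO6 hRed hcell hr hN hK hHg κ hκ γ 𝔭 h𝔭 he hf 𝔭' h𝔭' hne ι' hι ΩK Ωp L hΩK hΩp hBDP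
  exact ⟨∅, Set.finite_empty, μ, hT⟩

/-- **K1 BY NAME from P ∧ the PRIMITIVE layer tower** (P = `ResidualSelmerPrintedInputAtThree`, CGLS22 Prop. 14, item 26897;
IX `cumulativeHeegnerInclusionAtThree_of_print_of_fittingLayerTower_anySigma` at `S = ∅`).
[cite: CastellaGrossiLeeSkinner2022, §1.2 Prop. 14 (arXiv:2008.02571)] [cite: GreenbergLNM1716, §3 Lemma 3.3] -/
theorem cumulativeHeegnerInclusionAtThree_of_print_of_primitiveFittingLayerTower
    (hP : Summit.BirchSwinnertonDyer.BirchSwinnertonDyer.Theses.CumulativeHeegnerLeopoldt.ResidualSelmerPrintedInputAtThree)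
    (hLT : ∀ (W : WeierstrassCurve ℚ) [W.IsElliptic] [W.IsGloballyMinimal] (N : ℕ) [NeZero N] (K : Type) [Field K] [NumberField K] (Dt : Literature.NumberTheory.EllipticCurves.ModularForms.ModularParametrizationData W N), Summit.BirchSwinnertonDyer.Rank1Residual.Additive.ClassO6 W 3 → Literature.NumberTheory.EllipticCurves.Rank1Residual.Red W 3 → (∃ Φ : AddSubgroup (WeierstrassCurve.geomTorsion W ((3 : ℕ) : ℤ)), Literature.NumberTheory.EllipticCurves.Rank1Residual.IsRationalLine W 3 Φ ∧ ∀ (v : IsDedekindDomain.HeightOneSpectrum (NumberField.RingOfIntegers ℚ)), ((3 : ℕ) : NumberField.RingOfIntegers ℚ) ∈ v.asIdeal → ∀ 𝔓 ∈ v.primesAbove, ¬ (∀ g ∈ 𝔓.decompositionSubgroup (Field.absoluteGaloisGroup ℚ), ∀ P ∈ Φ, g • P = P) ∧ ¬ (∀ g ∈ 𝔓.decompositionSubgroup (Field.absoluteGaloisGroup ℚ), ∀ P : WeierstrassCurve.geomTorsion W ((3 : ℕ) : ℤ), g • P - P ∈ Φ)) → W.analyticRank = 1 → W.conductorNorm ℤ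 = N → Literature.NumberTheory.EllipticCurves.IsImaginaryQuadratic K → Literature.NumberTheory.EllipticCurves.SatisfiesHeegnerHypothesis N K → ∀ (κ : Literature.NumberTheory.EllipticCurves.ZpExtension K 3), κ.IsAnticyclotomic → ∀ (γ : Field.absoluteGaloisGroup K) [Fact (κ.IsTopGenerator γ)] (𝔭 : IsDedekindDomain.HeightOneSpectrum (NumberField.RingOfIntegers K)), ((3 : ℕ) : NumberField.RingOfIntegers K) ∈ 𝔭.asIdeal → 𝔭.asIdeal.ramificationIdx (NumberField.RingOfIntegers ℚ) = 1 → 𝔭.asIdeal.inertiaDeg (NumberField.RingOfIntegers ℚ) = 1 → ∀ (𝔭' : IsDedekindDomain.HeightOneSpectrum (NumberField.RingOfIntegers K)), ((3 : ℕ) : NumberField.RingOfIntegers K) ∈ 𝔭'.asIdeal → 𝔭' ≠ 𝔭 → ∀ (ι' : PadicAlgCl 3 ≃+* ℂ), Summit.BirchSwinnertonDyer.BirchSwinnertonDyer.Theorems.SchneiderFree.BranchInducesPrime 3 ι' 𝔭 → ∀ (ΩK : ℂ) (Ωp : ℂ_[3]) (L : Literature.NumberTheory.EllipticCurves.UnrSeries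 3), ΩK ≠ 0 → Ωp ≠ 0 → Literature.NumberTheory.EllipticCurves.IsBDPLFunction ι' 𝔭 κ γ Dt.f ΩK Ωp L →
      haveI : (W.baseChange K).IsElliptic := inferInstanceAs (W.map (algebraMap ℚ K)).IsElliptic
      ∃ μ : ℕ, ∀ m : ℕ,
        ∃ (f : AddMonoid.End ↥(selmerOver (κ.layerSubgroup m) ((W.baseChange K).geomPrimaryTorsion 3) 3 𝔭' ∅))
          (_ : ∀ s, ((f s : selmerOver (κ.layerSubgroup m) ((W.baseChange K).geomPrimaryTorsion 3) 3 𝔭' ∅) :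
            (W.baseChange K).subgroupH1 3 (κ.layerSubgroup m)) = (W.baseChange K).conjH1 3 (κ.layerSubgroup m) γ s)
          (h : IsLocNil 3 (f - 1)) (θ : UnrSeries 3),
          θ ∈ (Module.fittingIdeal (IwasawaAlgebra 3)
            (LocNilDual (selmerOver (κ.layerSubgroup m) ((W.baseChange K).geomPrimaryTorsion 3) 3 𝔭' ∅) f h) 0).map
              (PowerSeries.map (Halves.toUnr 3)) ∧
          (3 : UnrSeries 3) ^ μ * L ∈ Ideal.span {θ} ⊔ Ideal.span {(3 : UnrSeries 3) ^ m} ⊔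
            Ideal.span {((1 + PowerSeries.X) ^ (3 ^ m) - 1 : UnrSeries 3)}) :
    Summit.BirchSwinnertonDyer.BirchSwinnertonDyer.Theses.CumulativeHeegnerLeopoldt.CumulativeHeegnerInclusionAtThree := by
  refine cumulativeHeegnerInclusionAtThree_of_print_of_fittingLayerTower_anySigma hP ?_
  intro W _ _ N _ K _ _ Dt hO6 hRed hcell hr hN hK hHg κ hκ γ _ 𝔭 h𝔭 he hf 𝔭' h𝔭' hne ι' hι ΩK Ωp L hΩK hΩp hBDP
  obtain ⟨μ, hT⟩ := hLT W N K Dt hO6 hRed hcell hr hN hK hHg κ hκ γ 𝔭 h𝔭 he hf 𝔭' h𝔭' hne ι' hι ΩK Ωp L hΩK hΩp hBDP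
  exact ⟨∅, Set.finite_empty, μ, hT⟩

end Summit.BirchSwinnertonDyer.BirchSwinnertonDyer.Theorems.CumulativeHeegnerInclusionAtThreeLayerLocalKernelCount

end
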